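import Mathlib
import Literature.Claims.NS.Dicks2026
import Literature.Analysis.FluidPDE.KNSSMildBootstrapTools
import HarnessLib

/-!
# Prop31Charitable

Topic `Literature/Uncategorized`. Named literature fact(s) relocated by the gate from `Summits/NavierStokesRegularity/NavierStokesRegularity/Theorems/SoloRefuteDicks2026Charitable.lean`
(accept-time relocation of `[cite]`d propositions written inline in a Summits proposal; human ruling 2026-08-15).
Sources: Dicks2026.

* `Literature.Uncategorized.Prop31_charitable`
-/

namespace Literature.Uncategorized

open Filter Topology Set MeasureTheory
open scoped ENNReal
open Literature.Claims.NS.Dicks2026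

/-- **CHARITY-I face of Prop 3.1**: nonnegative profile, `E(T*) = ⊤`, finite dissipation on every
`(0, T)` (the print's (16)), `0 ≤ T*`, blow-up from the left ⇒ Case 1 ∨ Case 2 ∨ Case 3 (finite right
limit). [cite: Dicks2026, Prop 3.1 p.6 l.19–36; Lemma 3.3 (16) p.6 l.72–77] -/
def Prop31_charitable : Prop :=
  ∀ (E : ℝ → ℝ≥0∞) (Ts : ℝ), 0 ≤ Ts → E Ts = ⊤ →
    (∀ T : ℝ, 0 < T → (∫⁻ s in Ioo 0 T, E s) < ⊤) →
    BlowsUpLeft (fun t => (E t : EReal)) Ts →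
    Case1 (fun t => (E t : EReal)) Ts ∨ Case2 (fun t => (E t : EReal)) Ts ∨
      Case3 (fun t => (E t : EReal)) Ts

end Literature.Uncategorized
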